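/-
Copyright: the b2b-balaban T⁴-continuum CRUX team, row NE7b OWNER lineage `t4-ne7b-p1` (gen 146). Project licence.
-/
import Summits.QuantumFields.BalabanUV.T4Continuum.Spine.NE7b.SupHomogeneousFourPointBounds
import Summits.QuantumFields.BalabanUV.T4Continuum.Spine.NE7b.SupWhitenedThirdGradGradCumulantRaw

/-!
# THE FOUR-POINT DISPLAY WITH ONE BOUNDED VERTEX — TILTED FORMAT (SCOPING-d17 §F, F11: the homogeneous bound behind the
# interpolation of the SUPPORTED TREE terms `𝟙[Hk ≠ 0]·C4·T16` of `M₅` ((610), pieces (604))).  The fourth-cumulant display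
#   `E[B̂F̂ĜĤ] − E[B̂F̂]E[ĜĤ] − E[B̂Ĝ]E[F̂Ĥ] − E[B̂Ĥ]E[F̂Ĝ]`
# with ONE bounded centred vertex `B = P∘(A·+ψ)`, `|P| ≤ β`, and three gradient legs is bounded by `8β·√M₁·√√M₁` ((673)
# `centred_quad_le_of_bounded_first∕second` on the whitened tilted law with the fourth-moment letter `M₁ = 5κ₂⁴γ_op²∕(1−λγ_op)²` of (465)),
# vertex FIRST (the `x`-slot Hessian `U″[e_x,e_y]` of (609)'s group five) or SECOND (the pair Hessians of (608)'s group four); then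
# transported to the tilted format under `N(0,AAᵀ)` by (566)'s `whitened_observable_bridge` (row NE7b, node U5c; (465), (566), (673), (674) BY
# NAME; [folklore]).

Cell `pub-balaban`, sub-cell `t4`, spine estimate NE7b (`T4WeightBudget.RelWeightBound`; the cell's OWN estimate — NOT PRINTED in
[Bałaban 1983–89], NOT PROVED).  Crux-route work under `Spine/NE7b/` by the row OWNER (`t4-ne7b-p1` gen 146, file (677)) under FREEZE
(0)'s crux-prover clause; NOTHING of Bałaban's is named as a Lean object, valued or asserted; no `T4Continuum/Support` leaf typed; no
`def`, no notation (every display WRITTEN OUT); zero `sorry`.  Imports (BY NAME): the OWNER's (676) `…SupHomogeneousFourPointBounds` ((673)∕(674)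
through it), (566) `…SupWhitenedThirdGradGradCumulantRaw` (`whitened_observable_bridge`).

WHAT IS PROVED ([folklore]): **`tilted_quad_vertex_first`**, **`tilted_quad_vertex_second`** ((676)'s Gibbs-format bounds transported by
eleven `whitened_observable_bridge` rewrites each); toy.

HONEST (what this is NOT).  Moment inequalities and their format transport; the interpolated order-5 entries `M₅′` and their weighted slot
letters are the next files; scalar skeleton ((A3), NC-NE7b-α UNRULED); nothing of Bałaban's asserted.  BY-NAME EFFECT ON THE WALL: NONE.  NE7b
NOT PRINTED ∕ NOT PROVED; spine PROVED 0∕9; rung (B)+1 — the programme's measures remain FINITE-torus statements; NOT the mass gap, NOT Clay.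
HONEST DEPENDENCY: continuum YM on T⁴ ⇐ BetaPertH ∧ nine spine estimates (0∕9 proved); BetaPertH ⇐ (D1) ∧ (D4) ∧ CAP+tail; G-an2-4 gates
asym, D1 and NE2∕3∕4.
-/

set_option autoImplicit false
set_option maxSynthPendingDepth 2

noncomputable section

namespace Summit.QuantumFields.BalabanUV.T4Continuum.NE7b.SupHomogeneousFourPointBoundsTilted

open MeasureTheory ProbabilityTheory Real Set Function Finset Matrix
open scoped BigOperators
open Literature.Probability.Distributions (matrixCLM)
open SupWhitenedThirdGradGradCumulantRaw (whitened_observable_bridge)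
open SupHomogeneousFourPointBounds (gibbs_quad_vertex_first gibbs_quad_vertex_second)

variable {ι κ : Type} [Fintype ι] [DecidableEq ι] [Fintype κ] [DecidableEq κ]

variable {U : EuclideanSpace ℝ ι → ℝ} {U' : EuclideanSpace ℝ ι → EuclideanSpace ℝ ι →L[ℝ] ℝ}
  {U'' : EuclideanSpace ℝ ι → EuclideanSpace ℝ ι →L[ℝ] EuclideanSpace ℝ ι →L[ℝ] ℝ}
  {A : Matrix ι κ ℝ} {γop κ₀ κ₁ κ₂ a τ δ θp lam : ℝ}

/-! ## §1. Tilted format under `N(0,AAᵀ)` -/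

/-- **FOUR-POINT DISPLAY, BOUNDED VERTEX FIRST, TILTED FORMAT** under `N(0,AAᵀ)`: `≤ 8β·√M₁·√√M₁`. [folklore] -/
theorem tilted_quad_vertex_first [Nonempty κ] (hΓop : (γop • (1 : Matrix ι ι ℝ) - A * Aᵀ).PosSemidef) (Y : Finset ι)
    (hUd : ∀ φ : EuclideanSpace ℝ ι, HasFDerivAt U (U' φ) φ) (hU'd : ∀ φ : EuclideanSpace ℝ ι, HasFDerivAt U' (U'' φ) φ) (hU''c : Continuous U'')
    (hκ₀ : 0 ≤ κ₀) (hκ₁ : 0 ≤ κ₁) (ha : 0 ≤ a) (hτ : 0 < τ) (hδ : 0 < δ) (hθ0 : 0 < θp) (hθ1 : θp < 1) (hκθ : (2 * κ₀ * (1 + τ) + 4 * δ) * γop ≤ θp)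
    (hstab : ∀ φ : EuclideanSpace ℝ ι, -(κ₀ * ∑ x ∈ Y, φ x ^ 2) ≤ U φ) (hU'b : ∀ φ : EuclideanSpace ℝ ι, ‖U' φ‖ ≤ κ₁ * (a + ∑ x ∈ Y, φ x ^ 2))
    (hU''b : ∀ φ : EuclideanSpace ℝ ι, ‖U'' φ‖ ≤ κ₂) (hlam : 0 ≤ lam)
    (hUsec : ∀ s : ℝ, 0 ≤ s → s ≤ 1 → ∀ a b : EuclideanSpace ℝ ι, U ((1 - s) • a + s • b) - lam / 2 * (s * (1 - s)) * ∑ i, (a i - b i) ^ 2 ≤ (1 -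
        s) * U a + s * U b)
    (hρ : lam * γop < 1) {P : EuclideanSpace ℝ ι → ℝ} {β : ℝ} (hβ : 0 ≤ β) (hP : ∀ φ, |P φ| ≤ β) (hPc : Continuous P) (ψ : EuclideanSpace ℝ ι) (z
        t s : ι) :
    |(((∫ ω : EuclideanSpace ℝ ι, exp (-U (ω + ψ)) ∂(multivariateGaussian 0 (A * Aᵀ)))⁻¹ * (∫ ω : EuclideanSpace ℝ ι, exp (-U (ω + ψ)) * ((P (ω +
        ψ) - ((∫ ω : EuclideanSpace ℝ ι, exp (-U (ω + ψ)) ∂(multivariateGaussian 0 (A * Aᵀ)))⁻¹ * (∫ ω : EuclideanSpace ℝ ι, exp (-U (ω + ψ)) * P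
        (ω + ψ) ∂(multivariateGaussian 0 (A * Aᵀ))))) * (U' (ω + ψ) (EuclideanSpace.single z (1 : ℝ)) - ((∫ ω : EuclideanSpace ℝ ι, exp (-U (ω +
        ψ)) ∂(multivariateGaussian 0 (A * Aᵀ)))⁻¹ * (∫ ω : EuclideanSpace ℝ ι, exp (-U (ω + ψ)) * U' (ω + ψ) (EuclideanSpace.single z (1 : ℝ))
        ∂(multivariateGaussian 0 (A * Aᵀ))))) * (U' (ω + ψ) (EuclideanSpace.single t (1 : ℝ)) - ((∫ ω : EuclideanSpace ℝ ι, exp (-U (ω + ψ))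
        ∂(multivariateGaussian 0 (A * Aᵀ)))⁻¹ * (∫ ω : EuclideanSpace ℝ ι, exp (-U (ω + ψ)) * U' (ω + ψ) (EuclideanSpace.single t (1 : ℝ))
        ∂(multivariateGaussian 0 (A * Aᵀ))))) * (U' (ω + ψ) (EuclideanSpace.single s (1 : ℝ)) - ((∫ ω : EuclideanSpace ℝ ι, exp (-U (ω + ψ))
        ∂(multivariateGaussian 0 (A * Aᵀ)))⁻¹ * (∫ ω : EuclideanSpace ℝ ι, exp (-U (ω + ψ)) * U' (ω + ψ) (EuclideanSpace.single s (1 : ℝ))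
        ∂(multivariateGaussian 0 (A * Aᵀ)))))) ∂(multivariateGaussian 0 (A * Aᵀ)))) - ((∫ ω : EuclideanSpace ℝ ι, exp (-U (ω + ψ))
        ∂(multivariateGaussian 0 (A * Aᵀ)))⁻¹ * (∫ ω : EuclideanSpace ℝ ι, exp (-U (ω + ψ)) * ((P (ω + ψ) - ((∫ ω : EuclideanSpace ℝ ι, exp (-U
        (ω + ψ)) ∂(multivariateGaussian 0 (A * Aᵀ)))⁻¹ * (∫ ω : EuclideanSpace ℝ ι, exp (-U (ω + ψ)) * P (ω + ψ) ∂(multivariateGaussian 0 (A *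
        Aᵀ))))) * (U' (ω + ψ) (EuclideanSpace.single z (1 : ℝ)) - ((∫ ω : EuclideanSpace ℝ ι, exp (-U (ω + ψ)) ∂(multivariateGaussian 0 (A *
        Aᵀ)))⁻¹ * (∫ ω : EuclideanSpace ℝ ι, exp (-U (ω + ψ)) * U' (ω + ψ) (EuclideanSpace.single z (1 : ℝ)) ∂(multivariateGaussian 0 (A *
        Aᵀ)))))) ∂(multivariateGaussian 0 (A * Aᵀ)))) * ((∫ ω : EuclideanSpace ℝ ι, exp (-U (ω + ψ)) ∂(multivariateGaussian 0 (A * Aᵀ)))⁻¹ * (∫ ω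
        : EuclideanSpace ℝ ι, exp (-U (ω + ψ)) * ((U' (ω + ψ) (EuclideanSpace.single t (1 : ℝ)) - ((∫ ω : EuclideanSpace ℝ ι, exp (-U (ω + ψ))
        ∂(multivariateGaussian 0 (A * Aᵀ)))⁻¹ * (∫ ω : EuclideanSpace ℝ ι, exp (-U (ω + ψ)) * U' (ω + ψ) (EuclideanSpace.single t (1 : ℝ))
        ∂(multivariateGaussian 0 (A * Aᵀ))))) * (U' (ω + ψ) (EuclideanSpace.single s (1 : ℝ)) - ((∫ ω : EuclideanSpace ℝ ι, exp (-U (ω + ψ))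
        ∂(multivariateGaussian 0 (A * Aᵀ)))⁻¹ * (∫ ω : EuclideanSpace ℝ ι, exp (-U (ω + ψ)) * U' (ω + ψ) (EuclideanSpace.single s (1 : ℝ))
        ∂(multivariateGaussian 0 (A * Aᵀ)))))) ∂(multivariateGaussian 0 (A * Aᵀ)))) - ((∫ ω : EuclideanSpace ℝ ι, exp (-U (ω + ψ))
        ∂(multivariateGaussian 0 (A * Aᵀ)))⁻¹ * (∫ ω : EuclideanSpace ℝ ι, exp (-U (ω + ψ)) * ((P (ω + ψ) - ((∫ ω : EuclideanSpace ℝ ι, exp (-U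
        (ω + ψ)) ∂(multivariateGaussian 0 (A * Aᵀ)))⁻¹ * (∫ ω : EuclideanSpace ℝ ι, exp (-U (ω + ψ)) * P (ω + ψ) ∂(multivariateGaussian 0 (A *
        Aᵀ))))) * (U' (ω + ψ) (EuclideanSpace.single t (1 : ℝ)) - ((∫ ω : EuclideanSpace ℝ ι, exp (-U (ω + ψ)) ∂(multivariateGaussian 0 (A *
        Aᵀ)))⁻¹ * (∫ ω : EuclideanSpace ℝ ι, exp (-U (ω + ψ)) * U' (ω + ψ) (EuclideanSpace.single t (1 : ℝ)) ∂(multivariateGaussian 0 (A *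
        Aᵀ)))))) ∂(multivariateGaussian 0 (A * Aᵀ)))) * ((∫ ω : EuclideanSpace ℝ ι, exp (-U (ω + ψ)) ∂(multivariateGaussian 0 (A * Aᵀ)))⁻¹ * (∫ ω
        : EuclideanSpace ℝ ι, exp (-U (ω + ψ)) * ((U' (ω + ψ) (EuclideanSpace.single z (1 : ℝ)) - ((∫ ω : EuclideanSpace ℝ ι, exp (-U (ω + ψ))
        ∂(multivariateGaussian 0 (A * Aᵀ)))⁻¹ * (∫ ω : EuclideanSpace ℝ ι, exp (-U (ω + ψ)) * U' (ω + ψ) (EuclideanSpace.single z (1 : ℝ))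
        ∂(multivariateGaussian 0 (A * Aᵀ))))) * (U' (ω + ψ) (EuclideanSpace.single s (1 : ℝ)) - ((∫ ω : EuclideanSpace ℝ ι, exp (-U (ω + ψ))
        ∂(multivariateGaussian 0 (A * Aᵀ)))⁻¹ * (∫ ω : EuclideanSpace ℝ ι, exp (-U (ω + ψ)) * U' (ω + ψ) (EuclideanSpace.single s (1 : ℝ))
        ∂(multivariateGaussian 0 (A * Aᵀ)))))) ∂(multivariateGaussian 0 (A * Aᵀ)))) - ((∫ ω : EuclideanSpace ℝ ι, exp (-U (ω + ψ))
        ∂(multivariateGaussian 0 (A * Aᵀ)))⁻¹ * (∫ ω : EuclideanSpace ℝ ι, exp (-U (ω + ψ)) * ((P (ω + ψ) - ((∫ ω : EuclideanSpace ℝ ι, exp (-U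
        (ω + ψ)) ∂(multivariateGaussian 0 (A * Aᵀ)))⁻¹ * (∫ ω : EuclideanSpace ℝ ι, exp (-U (ω + ψ)) * P (ω + ψ) ∂(multivariateGaussian 0 (A *
        Aᵀ))))) * (U' (ω + ψ) (EuclideanSpace.single s (1 : ℝ)) - ((∫ ω : EuclideanSpace ℝ ι, exp (-U (ω + ψ)) ∂(multivariateGaussian 0 (A *
        Aᵀ)))⁻¹ * (∫ ω : EuclideanSpace ℝ ι, exp (-U (ω + ψ)) * U' (ω + ψ) (EuclideanSpace.single s (1 : ℝ)) ∂(multivariateGaussian 0 (A *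
        Aᵀ)))))) ∂(multivariateGaussian 0 (A * Aᵀ)))) * ((∫ ω : EuclideanSpace ℝ ι, exp (-U (ω + ψ)) ∂(multivariateGaussian 0 (A * Aᵀ)))⁻¹ * (∫ ω
        : EuclideanSpace ℝ ι, exp (-U (ω + ψ)) * ((U' (ω + ψ) (EuclideanSpace.single z (1 : ℝ)) - ((∫ ω : EuclideanSpace ℝ ι, exp (-U (ω + ψ))
        ∂(multivariateGaussian 0 (A * Aᵀ)))⁻¹ * (∫ ω : EuclideanSpace ℝ ι, exp (-U (ω + ψ)) * U' (ω + ψ) (EuclideanSpace.single z (1 : ℝ))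
        ∂(multivariateGaussian 0 (A * Aᵀ))))) * (U' (ω + ψ) (EuclideanSpace.single t (1 : ℝ)) - ((∫ ω : EuclideanSpace ℝ ι, exp (-U (ω + ψ))
        ∂(multivariateGaussian 0 (A * Aᵀ)))⁻¹ * (∫ ω : EuclideanSpace ℝ ι, exp (-U (ω + ψ)) * U' (ω + ψ) (EuclideanSpace.single t (1 : ℝ))
        ∂(multivariateGaussian 0 (A * Aᵀ)))))) ∂(multivariateGaussian 0 (A * Aᵀ)))))| ≤
      8 * β * (Real.sqrt (5 * (κ₂ ^ 4 * γop ^ 2) / (1 - lam * γop) ^ 2) * Real.sqrt (Real.sqrt (5 * (κ₂ ^ 4 * γop ^ 2) / (1 - lam * γop) ^ 2)))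
        := by
  have hUc : Continuous U := continuous_iff_continuousAt.2 fun φ => (hUd φ).continuousAt
  have hU'c : Continuous U' := continuous_iff_continuousAt.2 fun φ => (hU'd φ).continuousAt
  have h := gibbs_quad_vertex_first hΓop Y hUd hU'd hU''c hκ₀ hκ₁ ha hτ hδ hθ0 hθ1 hκθ hstab hU'b hU''b hlam hUsec hρ hβ hP ψ z t s
  have hq := whitened_observable_bridge (U := U) hUc A ψ (p := fun φ => (P φ - ∫ w', P (matrixCLM A (WithLp.toLp 2 w') + ψ) ∂((volume : Measure (κ →
    ℝ)).tilted fun z => -(1 / 2 * (z ⬝ᵥ z) + U (matrixCLM A (WithLp.toLp 2 z) + ψ)))) * (U' φ (EuclideanSpace.single z (1 : ℝ)) - ∫ w', U'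
    (matrixCLM A (WithLp.toLp 2 w') + ψ) (EuclideanSpace.single z (1 : ℝ)) ∂((volume : Measure (κ → ℝ)).tilted fun z => -(1 / 2 * (z ⬝ᵥ z) + U
    (matrixCLM A (WithLp.toLp 2 z) + ψ)))) * (U' φ (EuclideanSpace.single t (1 : ℝ)) - ∫ w', U' (matrixCLM A (WithLp.toLp 2 w') + ψ)
    (EuclideanSpace.single t (1 : ℝ)) ∂((volume : Measure (κ → ℝ)).tilted fun z => -(1 / 2 * (z ⬝ᵥ z) + U (matrixCLM A (WithLp.toLp 2 z) + ψ)))) *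
    (U' φ (EuclideanSpace.single s (1 : ℝ)) - ∫ w', U' (matrixCLM A (WithLp.toLp 2 w') + ψ) (EuclideanSpace.single s (1 : ℝ)) ∂((volume : Measure (κ
    → ℝ)).tilted fun z => -(1 / 2 * (z ⬝ᵥ z) + U (matrixCLM A (WithLp.toLp 2 z) + ψ))))) (((((hPc).sub continuous_const).mul (((hU'c.clm_apply
    continuous_const)).sub continuous_const)).mul (((hU'c.clm_apply continuous_const)).sub continuous_const)).mul (((hU'c.clm_apply
    continuous_const)).sub continuous_const))
  beta_reduce at hq
  have hp01 := whitened_observable_bridge (U := U) hUc A ψ (p := fun φ => (P φ - ∫ w', P (matrixCLM A (WithLp.toLp 2 w') + ψ) ∂((volume : Measure (κ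
    → ℝ)).tilted fun z => -(1 / 2 * (z ⬝ᵥ z) + U (matrixCLM A (WithLp.toLp 2 z) + ψ)))) * (U' φ (EuclideanSpace.single z (1 : ℝ)) - ∫ w', U'
    (matrixCLM A (WithLp.toLp 2 w') + ψ) (EuclideanSpace.single z (1 : ℝ)) ∂((volume : Measure (κ → ℝ)).tilted fun z => -(1 / 2 * (z ⬝ᵥ z) + U
    (matrixCLM A (WithLp.toLp 2 z) + ψ))))) (((hPc).sub continuous_const).mul (((hU'c.clm_apply continuous_const)).sub continuous_const))
  beta_reduce at hp01
  have hp23 := whitened_observable_bridge (U := U) hUc A ψ (p := fun φ => (U' φ (EuclideanSpace.single t (1 : ℝ)) - ∫ w', U' (matrixCLM A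
    (WithLp.toLp 2 w') + ψ) (EuclideanSpace.single t (1 : ℝ)) ∂((volume : Measure (κ → ℝ)).tilted fun z => -(1 / 2 * (z ⬝ᵥ z) + U (matrixCLM A
    (WithLp.toLp 2 z) + ψ)))) * (U' φ (EuclideanSpace.single s (1 : ℝ)) - ∫ w', U' (matrixCLM A (WithLp.toLp 2 w') + ψ) (EuclideanSpace.single s (1
    : ℝ)) ∂((volume : Measure (κ → ℝ)).tilted fun z => -(1 / 2 * (z ⬝ᵥ z) + U (matrixCLM A (WithLp.toLp 2 z) + ψ))))) ((((hU'c.clm_apply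
    continuous_const)).sub continuous_const).mul (((hU'c.clm_apply continuous_const)).sub continuous_const))
  beta_reduce at hp23
  have hp02 := whitened_observable_bridge (U := U) hUc A ψ (p := fun φ => (P φ - ∫ w', P (matrixCLM A (WithLp.toLp 2 w') + ψ) ∂((volume : Measure (κ
    → ℝ)).tilted fun z => -(1 / 2 * (z ⬝ᵥ z) + U (matrixCLM A (WithLp.toLp 2 z) + ψ)))) * (U' φ (EuclideanSpace.single t (1 : ℝ)) - ∫ w', U'
    (matrixCLM A (WithLp.toLp 2 w') + ψ) (EuclideanSpace.single t (1 : ℝ)) ∂((volume : Measure (κ → ℝ)).tilted fun z => -(1 / 2 * (z ⬝ᵥ z) + U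
    (matrixCLM A (WithLp.toLp 2 z) + ψ))))) (((hPc).sub continuous_const).mul (((hU'c.clm_apply continuous_const)).sub continuous_const))
  beta_reduce at hp02
  have hp13 := whitened_observable_bridge (U := U) hUc A ψ (p := fun φ => (U' φ (EuclideanSpace.single z (1 : ℝ)) - ∫ w', U' (matrixCLM A
    (WithLp.toLp 2 w') + ψ) (EuclideanSpace.single z (1 : ℝ)) ∂((volume : Measure (κ → ℝ)).tilted fun z => -(1 / 2 * (z ⬝ᵥ z) + U (matrixCLM A
    (WithLp.toLp 2 z) + ψ)))) * (U' φ (EuclideanSpace.single s (1 : ℝ)) - ∫ w', U' (matrixCLM A (WithLp.toLp 2 w') + ψ) (EuclideanSpace.single s (1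
    : ℝ)) ∂((volume : Measure (κ → ℝ)).tilted fun z => -(1 / 2 * (z ⬝ᵥ z) + U (matrixCLM A (WithLp.toLp 2 z) + ψ))))) ((((hU'c.clm_apply
    continuous_const)).sub continuous_const).mul (((hU'c.clm_apply continuous_const)).sub continuous_const))
  beta_reduce at hp13
  have hp03 := whitened_observable_bridge (U := U) hUc A ψ (p := fun φ => (P φ - ∫ w', P (matrixCLM A (WithLp.toLp 2 w') + ψ) ∂((volume : Measure (κ
    → ℝ)).tilted fun z => -(1 / 2 * (z ⬝ᵥ z) + U (matrixCLM A (WithLp.toLp 2 z) + ψ)))) * (U' φ (EuclideanSpace.single s (1 : ℝ)) - ∫ w', U'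
    (matrixCLM A (WithLp.toLp 2 w') + ψ) (EuclideanSpace.single s (1 : ℝ)) ∂((volume : Measure (κ → ℝ)).tilted fun z => -(1 / 2 * (z ⬝ᵥ z) + U
    (matrixCLM A (WithLp.toLp 2 z) + ψ))))) (((hPc).sub continuous_const).mul (((hU'c.clm_apply continuous_const)).sub continuous_const))
  beta_reduce at hp03
  have hp12 := whitened_observable_bridge (U := U) hUc A ψ (p := fun φ => (U' φ (EuclideanSpace.single z (1 : ℝ)) - ∫ w', U' (matrixCLM A
    (WithLp.toLp 2 w') + ψ) (EuclideanSpace.single z (1 : ℝ)) ∂((volume : Measure (κ → ℝ)).tilted fun z => -(1 / 2 * (z ⬝ᵥ z) + U (matrixCLM A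
    (WithLp.toLp 2 z) + ψ)))) * (U' φ (EuclideanSpace.single t (1 : ℝ)) - ∫ w', U' (matrixCLM A (WithLp.toLp 2 w') + ψ) (EuclideanSpace.single t (1
    : ℝ)) ∂((volume : Measure (κ → ℝ)).tilted fun z => -(1 / 2 * (z ⬝ᵥ z) + U (matrixCLM A (WithLp.toLp 2 z) + ψ))))) ((((hU'c.clm_apply
    continuous_const)).sub continuous_const).mul (((hU'c.clm_apply continuous_const)).sub continuous_const))
  beta_reduce at hp12
  have hm0 := whitened_observable_bridge (U := U) hUc A ψ (p := fun φ => P φ) hPc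
  beta_reduce at hm0
  have hm1 := whitened_observable_bridge (U := U) hUc A ψ (p := fun φ => U' φ (EuclideanSpace.single z (1 : ℝ))) (hU'c.clm_apply continuous_const)
  beta_reduce at hm1
  have hm2 := whitened_observable_bridge (U := U) hUc A ψ (p := fun φ => U' φ (EuclideanSpace.single t (1 : ℝ))) (hU'c.clm_apply continuous_const)
  beta_reduce at hm2
  have hm3 := whitened_observable_bridge (U := U) hUc A ψ (p := fun φ => U' φ (EuclideanSpace.single s (1 : ℝ))) (hU'c.clm_apply continuous_const)
  beta_reduce at hm3
  rw [hq, hp01, hp23, hp02, hp13, hp03, hp12, hm0, hm1, hm2, hm3] at h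
  exact h

/-- **FOUR-POINT DISPLAY, BOUNDED VERTEX SECOND, TILTED FORMAT** under `N(0,AAᵀ)`: `≤ 8β·√M₁·√√M₁`. [folklore] -/
theorem tilted_quad_vertex_second [Nonempty κ] (hΓop : (γop • (1 : Matrix ι ι ℝ) - A * Aᵀ).PosSemidef) (Y : Finset ι)
    (hUd : ∀ φ : EuclideanSpace ℝ ι, HasFDerivAt U (U' φ) φ) (hU'd : ∀ φ : EuclideanSpace ℝ ι, HasFDerivAt U' (U'' φ) φ) (hU''c : Continuous U'')
    (hκ₀ : 0 ≤ κ₀) (hκ₁ : 0 ≤ κ₁) (ha : 0 ≤ a) (hτ : 0 < τ) (hδ : 0 < δ) (hθ0 : 0 < θp) (hθ1 : θp < 1) (hκθ : (2 * κ₀ * (1 + τ) + 4 * δ) * γop ≤ θp)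
    (hstab : ∀ φ : EuclideanSpace ℝ ι, -(κ₀ * ∑ x ∈ Y, φ x ^ 2) ≤ U φ) (hU'b : ∀ φ : EuclideanSpace ℝ ι, ‖U' φ‖ ≤ κ₁ * (a + ∑ x ∈ Y, φ x ^ 2))
    (hU''b : ∀ φ : EuclideanSpace ℝ ι, ‖U'' φ‖ ≤ κ₂) (hlam : 0 ≤ lam)
    (hUsec : ∀ s : ℝ, 0 ≤ s → s ≤ 1 → ∀ a b : EuclideanSpace ℝ ι, U ((1 - s) • a + s • b) - lam / 2 * (s * (1 - s)) * ∑ i, (a i - b i) ^ 2 ≤ (1 -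
        s) * U a + s * U b)
    (hρ : lam * γop < 1) {P : EuclideanSpace ℝ ι → ℝ} {β : ℝ} (hβ : 0 ≤ β) (hP : ∀ φ, |P φ| ≤ β) (hPc : Continuous P) (ψ : EuclideanSpace ℝ ι) (x
        t s : ι) :
    |(((∫ ω : EuclideanSpace ℝ ι, exp (-U (ω + ψ)) ∂(multivariateGaussian 0 (A * Aᵀ)))⁻¹ * (∫ ω : EuclideanSpace ℝ ι, exp (-U (ω + ψ)) * ((U' (ω
        + ψ) (EuclideanSpace.single x (1 : ℝ)) - ((∫ ω : EuclideanSpace ℝ ι, exp (-U (ω + ψ)) ∂(multivariateGaussian 0 (A * Aᵀ)))⁻¹ * (∫ ω :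
        EuclideanSpace ℝ ι, exp (-U (ω + ψ)) * U' (ω + ψ) (EuclideanSpace.single x (1 : ℝ)) ∂(multivariateGaussian 0 (A * Aᵀ))))) * (P (ω + ψ) -
        ((∫ ω : EuclideanSpace ℝ ι, exp (-U (ω + ψ)) ∂(multivariateGaussian 0 (A * Aᵀ)))⁻¹ * (∫ ω : EuclideanSpace ℝ ι, exp (-U (ω + ψ)) * P (ω +
        ψ) ∂(multivariateGaussian 0 (A * Aᵀ))))) * (U' (ω + ψ) (EuclideanSpace.single t (1 : ℝ)) - ((∫ ω : EuclideanSpace ℝ ι, exp (-U (ω + ψ))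
        ∂(multivariateGaussian 0 (A * Aᵀ)))⁻¹ * (∫ ω : EuclideanSpace ℝ ι, exp (-U (ω + ψ)) * U' (ω + ψ) (EuclideanSpace.single t (1 : ℝ))
        ∂(multivariateGaussian 0 (A * Aᵀ))))) * (U' (ω + ψ) (EuclideanSpace.single s (1 : ℝ)) - ((∫ ω : EuclideanSpace ℝ ι, exp (-U (ω + ψ))
        ∂(multivariateGaussian 0 (A * Aᵀ)))⁻¹ * (∫ ω : EuclideanSpace ℝ ι, exp (-U (ω + ψ)) * U' (ω + ψ) (EuclideanSpace.single s (1 : ℝ))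
        ∂(multivariateGaussian 0 (A * Aᵀ)))))) ∂(multivariateGaussian 0 (A * Aᵀ)))) - ((∫ ω : EuclideanSpace ℝ ι, exp (-U (ω + ψ))
        ∂(multivariateGaussian 0 (A * Aᵀ)))⁻¹ * (∫ ω : EuclideanSpace ℝ ι, exp (-U (ω + ψ)) * ((U' (ω + ψ) (EuclideanSpace.single x (1 : ℝ)) -
        ((∫ ω : EuclideanSpace ℝ ι, exp (-U (ω + ψ)) ∂(multivariateGaussian 0 (A * Aᵀ)))⁻¹ * (∫ ω : EuclideanSpace ℝ ι, exp (-U (ω + ψ)) * U' (ω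
        + ψ) (EuclideanSpace.single x (1 : ℝ)) ∂(multivariateGaussian 0 (A * Aᵀ))))) * (P (ω + ψ) - ((∫ ω : EuclideanSpace ℝ ι, exp (-U (ω + ψ))
        ∂(multivariateGaussian 0 (A * Aᵀ)))⁻¹ * (∫ ω : EuclideanSpace ℝ ι, exp (-U (ω + ψ)) * P (ω + ψ) ∂(multivariateGaussian 0 (A * Aᵀ))))))
        ∂(multivariateGaussian 0 (A * Aᵀ)))) * ((∫ ω : EuclideanSpace ℝ ι, exp (-U (ω + ψ)) ∂(multivariateGaussian 0 (A * Aᵀ)))⁻¹ * (∫ ω :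
        EuclideanSpace ℝ ι, exp (-U (ω + ψ)) * ((U' (ω + ψ) (EuclideanSpace.single t (1 : ℝ)) - ((∫ ω : EuclideanSpace ℝ ι, exp (-U (ω + ψ))
        ∂(multivariateGaussian 0 (A * Aᵀ)))⁻¹ * (∫ ω : EuclideanSpace ℝ ι, exp (-U (ω + ψ)) * U' (ω + ψ) (EuclideanSpace.single t (1 : ℝ))
        ∂(multivariateGaussian 0 (A * Aᵀ))))) * (U' (ω + ψ) (EuclideanSpace.single s (1 : ℝ)) - ((∫ ω : EuclideanSpace ℝ ι, exp (-U (ω + ψ))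
        ∂(multivariateGaussian 0 (A * Aᵀ)))⁻¹ * (∫ ω : EuclideanSpace ℝ ι, exp (-U (ω + ψ)) * U' (ω + ψ) (EuclideanSpace.single s (1 : ℝ))
        ∂(multivariateGaussian 0 (A * Aᵀ)))))) ∂(multivariateGaussian 0 (A * Aᵀ)))) - ((∫ ω : EuclideanSpace ℝ ι, exp (-U (ω + ψ))
        ∂(multivariateGaussian 0 (A * Aᵀ)))⁻¹ * (∫ ω : EuclideanSpace ℝ ι, exp (-U (ω + ψ)) * ((U' (ω + ψ) (EuclideanSpace.single x (1 : ℝ)) -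
        ((∫ ω : EuclideanSpace ℝ ι, exp (-U (ω + ψ)) ∂(multivariateGaussian 0 (A * Aᵀ)))⁻¹ * (∫ ω : EuclideanSpace ℝ ι, exp (-U (ω + ψ)) * U' (ω
        + ψ) (EuclideanSpace.single x (1 : ℝ)) ∂(multivariateGaussian 0 (A * Aᵀ))))) * (U' (ω + ψ) (EuclideanSpace.single t (1 : ℝ)) - ((∫ ω :
        EuclideanSpace ℝ ι, exp (-U (ω + ψ)) ∂(multivariateGaussian 0 (A * Aᵀ)))⁻¹ * (∫ ω : EuclideanSpace ℝ ι, exp (-U (ω + ψ)) * U' (ω + ψ)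
        (EuclideanSpace.single t (1 : ℝ)) ∂(multivariateGaussian 0 (A * Aᵀ)))))) ∂(multivariateGaussian 0 (A * Aᵀ)))) * ((∫ ω : EuclideanSpace ℝ
        ι, exp (-U (ω + ψ)) ∂(multivariateGaussian 0 (A * Aᵀ)))⁻¹ * (∫ ω : EuclideanSpace ℝ ι, exp (-U (ω + ψ)) * ((P (ω + ψ) - ((∫ ω :
        EuclideanSpace ℝ ι, exp (-U (ω + ψ)) ∂(multivariateGaussian 0 (A * Aᵀ)))⁻¹ * (∫ ω : EuclideanSpace ℝ ι, exp (-U (ω + ψ)) * P (ω + ψ)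
        ∂(multivariateGaussian 0 (A * Aᵀ))))) * (U' (ω + ψ) (EuclideanSpace.single s (1 : ℝ)) - ((∫ ω : EuclideanSpace ℝ ι, exp (-U (ω + ψ))
        ∂(multivariateGaussian 0 (A * Aᵀ)))⁻¹ * (∫ ω : EuclideanSpace ℝ ι, exp (-U (ω + ψ)) * U' (ω + ψ) (EuclideanSpace.single s (1 : ℝ))
        ∂(multivariateGaussian 0 (A * Aᵀ)))))) ∂(multivariateGaussian 0 (A * Aᵀ)))) - ((∫ ω : EuclideanSpace ℝ ι, exp (-U (ω + ψ))
        ∂(multivariateGaussian 0 (A * Aᵀ)))⁻¹ * (∫ ω : EuclideanSpace ℝ ι, exp (-U (ω + ψ)) * ((U' (ω + ψ) (EuclideanSpace.single x (1 : ℝ)) -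
        ((∫ ω : EuclideanSpace ℝ ι, exp (-U (ω + ψ)) ∂(multivariateGaussian 0 (A * Aᵀ)))⁻¹ * (∫ ω : EuclideanSpace ℝ ι, exp (-U (ω + ψ)) * U' (ω
        + ψ) (EuclideanSpace.single x (1 : ℝ)) ∂(multivariateGaussian 0 (A * Aᵀ))))) * (U' (ω + ψ) (EuclideanSpace.single s (1 : ℝ)) - ((∫ ω :
        EuclideanSpace ℝ ι, exp (-U (ω + ψ)) ∂(multivariateGaussian 0 (A * Aᵀ)))⁻¹ * (∫ ω : EuclideanSpace ℝ ι, exp (-U (ω + ψ)) * U' (ω + ψ)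
        (EuclideanSpace.single s (1 : ℝ)) ∂(multivariateGaussian 0 (A * Aᵀ)))))) ∂(multivariateGaussian 0 (A * Aᵀ)))) * ((∫ ω : EuclideanSpace ℝ
        ι, exp (-U (ω + ψ)) ∂(multivariateGaussian 0 (A * Aᵀ)))⁻¹ * (∫ ω : EuclideanSpace ℝ ι, exp (-U (ω + ψ)) * ((P (ω + ψ) - ((∫ ω :
        EuclideanSpace ℝ ι, exp (-U (ω + ψ)) ∂(multivariateGaussian 0 (A * Aᵀ)))⁻¹ * (∫ ω : EuclideanSpace ℝ ι, exp (-U (ω + ψ)) * P (ω + ψ)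
        ∂(multivariateGaussian 0 (A * Aᵀ))))) * (U' (ω + ψ) (EuclideanSpace.single t (1 : ℝ)) - ((∫ ω : EuclideanSpace ℝ ι, exp (-U (ω + ψ))
        ∂(multivariateGaussian 0 (A * Aᵀ)))⁻¹ * (∫ ω : EuclideanSpace ℝ ι, exp (-U (ω + ψ)) * U' (ω + ψ) (EuclideanSpace.single t (1 : ℝ))
        ∂(multivariateGaussian 0 (A * Aᵀ)))))) ∂(multivariateGaussian 0 (A * Aᵀ)))))| ≤
      8 * β * (Real.sqrt (5 * (κ₂ ^ 4 * γop ^ 2) / (1 - lam * γop) ^ 2) * Real.sqrt (Real.sqrt (5 * (κ₂ ^ 4 * γop ^ 2) / (1 - lam * γop) ^ 2)))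
        := by
  have hUc : Continuous U := continuous_iff_continuousAt.2 fun φ => (hUd φ).continuousAt
  have hU'c : Continuous U' := continuous_iff_continuousAt.2 fun φ => (hU'd φ).continuousAt
  have h := gibbs_quad_vertex_second hΓop Y hUd hU'd hU''c hκ₀ hκ₁ ha hτ hδ hθ0 hθ1 hκθ hstab hU'b hU''b hlam hUsec hρ hβ hP ψ x t s
  have hq := whitened_observable_bridge (U := U) hUc A ψ (p := fun φ => (U' φ (EuclideanSpace.single x (1 : ℝ)) - ∫ w', U' (matrixCLM A (WithLp.toLp
    2 w') + ψ) (EuclideanSpace.single x (1 : ℝ)) ∂((volume : Measure (κ → ℝ)).tilted fun z => -(1 / 2 * (z ⬝ᵥ z) + U (matrixCLM A (WithLp.toLp 2 z)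
    + ψ)))) * (P φ - ∫ w', P (matrixCLM A (WithLp.toLp 2 w') + ψ) ∂((volume : Measure (κ → ℝ)).tilted fun z => -(1 / 2 * (z ⬝ᵥ z) + U (matrixCLM A
    (WithLp.toLp 2 z) + ψ)))) * (U' φ (EuclideanSpace.single t (1 : ℝ)) - ∫ w', U' (matrixCLM A (WithLp.toLp 2 w') + ψ) (EuclideanSpace.single t (1
    : ℝ)) ∂((volume : Measure (κ → ℝ)).tilted fun z => -(1 / 2 * (z ⬝ᵥ z) + U (matrixCLM A (WithLp.toLp 2 z) + ψ)))) * (U' φ (EuclideanSpace.single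
    s (1 : ℝ)) - ∫ w', U' (matrixCLM A (WithLp.toLp 2 w') + ψ) (EuclideanSpace.single s (1 : ℝ)) ∂((volume : Measure (κ → ℝ)).tilted fun z => -(1 /
    2 * (z ⬝ᵥ z) + U (matrixCLM A (WithLp.toLp 2 z) + ψ))))) ((((((hU'c.clm_apply continuous_const)).sub continuous_const).mul ((hPc).sub
    continuous_const)).mul (((hU'c.clm_apply continuous_const)).sub continuous_const)).mul (((hU'c.clm_apply continuous_const)).sub
    continuous_const))
  beta_reduce at hq
  have hp01 := whitened_observable_bridge (U := U) hUc A ψ (p := fun φ => (U' φ (EuclideanSpace.single x (1 : ℝ)) - ∫ w', U' (matrixCLM A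
    (WithLp.toLp 2 w') + ψ) (EuclideanSpace.single x (1 : ℝ)) ∂((volume : Measure (κ → ℝ)).tilted fun z => -(1 / 2 * (z ⬝ᵥ z) + U (matrixCLM A
    (WithLp.toLp 2 z) + ψ)))) * (P φ - ∫ w', P (matrixCLM A (WithLp.toLp 2 w') + ψ) ∂((volume : Measure (κ → ℝ)).tilted fun z => -(1 / 2 * (z ⬝ᵥ z)
    + U (matrixCLM A (WithLp.toLp 2 z) + ψ))))) ((((hU'c.clm_apply continuous_const)).sub continuous_const).mul ((hPc).sub continuous_const))
  beta_reduce at hp01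
  have hp23 := whitened_observable_bridge (U := U) hUc A ψ (p := fun φ => (U' φ (EuclideanSpace.single t (1 : ℝ)) - ∫ w', U' (matrixCLM A
    (WithLp.toLp 2 w') + ψ) (EuclideanSpace.single t (1 : ℝ)) ∂((volume : Measure (κ → ℝ)).tilted fun z => -(1 / 2 * (z ⬝ᵥ z) + U (matrixCLM A
    (WithLp.toLp 2 z) + ψ)))) * (U' φ (EuclideanSpace.single s (1 : ℝ)) - ∫ w', U' (matrixCLM A (WithLp.toLp 2 w') + ψ) (EuclideanSpace.single s (1
    : ℝ)) ∂((volume : Measure (κ → ℝ)).tilted fun z => -(1 / 2 * (z ⬝ᵥ z) + U (matrixCLM A (WithLp.toLp 2 z) + ψ))))) ((((hU'c.clm_apply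
    continuous_const)).sub continuous_const).mul (((hU'c.clm_apply continuous_const)).sub continuous_const))
  beta_reduce at hp23
  have hp02 := whitened_observable_bridge (U := U) hUc A ψ (p := fun φ => (U' φ (EuclideanSpace.single x (1 : ℝ)) - ∫ w', U' (matrixCLM A
    (WithLp.toLp 2 w') + ψ) (EuclideanSpace.single x (1 : ℝ)) ∂((volume : Measure (κ → ℝ)).tilted fun z => -(1 / 2 * (z ⬝ᵥ z) + U (matrixCLM A
    (WithLp.toLp 2 z) + ψ)))) * (U' φ (EuclideanSpace.single t (1 : ℝ)) - ∫ w', U' (matrixCLM A (WithLp.toLp 2 w') + ψ) (EuclideanSpace.single t (1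
    : ℝ)) ∂((volume : Measure (κ → ℝ)).tilted fun z => -(1 / 2 * (z ⬝ᵥ z) + U (matrixCLM A (WithLp.toLp 2 z) + ψ))))) ((((hU'c.clm_apply
    continuous_const)).sub continuous_const).mul (((hU'c.clm_apply continuous_const)).sub continuous_const))
  beta_reduce at hp02
  have hp13 := whitened_observable_bridge (U := U) hUc A ψ (p := fun φ => (P φ - ∫ w', P (matrixCLM A (WithLp.toLp 2 w') + ψ) ∂((volume : Measure (κ
    → ℝ)).tilted fun z => -(1 / 2 * (z ⬝ᵥ z) + U (matrixCLM A (WithLp.toLp 2 z) + ψ)))) * (U' φ (EuclideanSpace.single s (1 : ℝ)) - ∫ w', U'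
    (matrixCLM A (WithLp.toLp 2 w') + ψ) (EuclideanSpace.single s (1 : ℝ)) ∂((volume : Measure (κ → ℝ)).tilted fun z => -(1 / 2 * (z ⬝ᵥ z) + U
    (matrixCLM A (WithLp.toLp 2 z) + ψ))))) (((hPc).sub continuous_const).mul (((hU'c.clm_apply continuous_const)).sub continuous_const))
  beta_reduce at hp13
  have hp03 := whitened_observable_bridge (U := U) hUc A ψ (p := fun φ => (U' φ (EuclideanSpace.single x (1 : ℝ)) - ∫ w', U' (matrixCLM A
    (WithLp.toLp 2 w') + ψ) (EuclideanSpace.single x (1 : ℝ)) ∂((volume : Measure (κ → ℝ)).tilted fun z => -(1 / 2 * (z ⬝ᵥ z) + U (matrixCLM A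
    (WithLp.toLp 2 z) + ψ)))) * (U' φ (EuclideanSpace.single s (1 : ℝ)) - ∫ w', U' (matrixCLM A (WithLp.toLp 2 w') + ψ) (EuclideanSpace.single s (1
    : ℝ)) ∂((volume : Measure (κ → ℝ)).tilted fun z => -(1 / 2 * (z ⬝ᵥ z) + U (matrixCLM A (WithLp.toLp 2 z) + ψ))))) ((((hU'c.clm_apply
    continuous_const)).sub continuous_const).mul (((hU'c.clm_apply continuous_const)).sub continuous_const))
  beta_reduce at hp03
  have hp12 := whitened_observable_bridge (U := U) hUc A ψ (p := fun φ => (P φ - ∫ w', P (matrixCLM A (WithLp.toLp 2 w') + ψ) ∂((volume : Measure (κ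
    → ℝ)).tilted fun z => -(1 / 2 * (z ⬝ᵥ z) + U (matrixCLM A (WithLp.toLp 2 z) + ψ)))) * (U' φ (EuclideanSpace.single t (1 : ℝ)) - ∫ w', U'
    (matrixCLM A (WithLp.toLp 2 w') + ψ) (EuclideanSpace.single t (1 : ℝ)) ∂((volume : Measure (κ → ℝ)).tilted fun z => -(1 / 2 * (z ⬝ᵥ z) + U
    (matrixCLM A (WithLp.toLp 2 z) + ψ))))) (((hPc).sub continuous_const).mul (((hU'c.clm_apply continuous_const)).sub continuous_const))
  beta_reduce at hp12
  have hm0 := whitened_observable_bridge (U := U) hUc A ψ (p := fun φ => U' φ (EuclideanSpace.single x (1 : ℝ))) (hU'c.clm_apply continuous_const)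
  beta_reduce at hm0
  have hm1 := whitened_observable_bridge (U := U) hUc A ψ (p := fun φ => P φ) hPc
  beta_reduce at hm1
  have hm2 := whitened_observable_bridge (U := U) hUc A ψ (p := fun φ => U' φ (EuclideanSpace.single t (1 : ℝ))) (hU'c.clm_apply continuous_const)
  beta_reduce at hm2
  have hm3 := whitened_observable_bridge (U := U) hUc A ψ (p := fun φ => U' φ (EuclideanSpace.single s (1 : ℝ))) (hU'c.clm_apply continuous_const)
  beta_reduce at hm3
  rw [hq, hp01, hp23, hp02, hp13, hp03, hp12, hm0, hm1, hm2, hm3] at h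
  exact h

/-! ## §2. Toy -/

/-- Toy (the bridge's algebra): tilted means are linear in the observable, `Z⁻¹(aI + bJ) = a·Z⁻¹I + b·Z⁻¹J`. -/
example (Z a b I J : ℝ) : Z⁻¹ * (a * I + b * J) = a * (Z⁻¹ * I) + b * (Z⁻¹ * J) := by ring

end Summit.QuantumFields.BalabanUV.T4Continuum.NE7b.SupHomogeneousFourPointBoundsTilted

end
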